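import Literature.Analysis.FluidPDE.LerayEnstrophyAPriori
import Literature.Analysis.FluidPDE.TrilinearSkew
import Literature.Analysis.FluidPDE.SobolevWeakGradient
import HarnessLib

/-!
# `L²` stability of classical solutions in the smooth `H¹` class
# (Robinson–Rodrigo–Sadowski 2016, (6.3) and the proof of Thm. 6.10)

Analysis/FluidPDE proof file (no named facts). For two classical solutions `(u, p)`, `(u', p')`
of the unforced Navier–Stokes system with the same viscosity `ν > 0` on a closed slab
`[0, T] × ℝ³`, both in the `L²`-Sobolev class of Tao's smooth `H¹` theory
(`u, ∂ₜu, p ∈ L^∞_t H^k_x`), the difference `w = u − u'` obeys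

  `‖w(t)‖²_{L²} ≤ ‖w(0)‖²_{L²} exp (C ν⁻³ S² t)`,   `S ≥ sup_{[0,T]} ∫ |∇u'|²`,

with an absolute constant `C` (`exists_l2_stability`). This is the estimate of
Robinson–Rodrigo–Sadowski 2016, proof of Thm. 6.10 (weak–strong uniqueness, PDF p. 106:
`½ d/dt ‖w‖² + ‖∇w‖² ≤ |⟨(w·∇)u, w⟩| ≤ c‖∇u‖⁴‖w‖² + ½‖∇w‖²`, "the Gronwall Lemma yields
`‖w(t)‖² ≤ ‖w(0)‖² exp(c∫₀ᵗ‖∇u‖⁴)`") and of their Lipschitz estimate (6.3), read for two strong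
solutions with *different* data; it is also the `L²` part of Tao 2011, Thm. 5.4 (v) (Lipschitz
stability). It is the convergence mechanism of the approximation scheme in the decomposition of
`tao2011_H1_local_almost_regular` (smooth data `u₀ⁿ → u₀` give solutions Cauchy in `C_t L²_x`,
uniformly thanks to `leray_enstrophy_apriori`).

## The argument

1. **Energy balance of the difference** (`IsSmoothSpaceTimeOn.l2_balance`):
   `E(b) − E(0) = ∫₀ᵇ 2∫⟪w, ∂ₜw⟫` for jointly smooth `w` with `w, ∂ₜw ∈ L^∞_t L²_x`
   (fundamental theorem of calculus on time lines and Fubini, as in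
   `IsSmoothSpaceTimeOn.enstrophy_balance`).
2. **Slice inequality** (`exists_l2_slice`): subtracting the momentum equations,
   `∂ₜw + (u·∇)w + (w·∇)u' = νΔw − ∇(p − p')`, so
   `∫⟪w, ∂ₜw⟫ = −ν∫|∇w|² − ∫⟪(w·∇)u', w⟫` (the transport term `∫⟪(u·∇)w, w⟫` vanishes by the
   skew-symmetry `integral_inner_weakGrad_apply_self_eq_zero`, the pressure term by
   `integral_inner_gradient_eq_zero_of_isDivFree_R3`, and `∫⟪w, Δw⟫ = −∫|∇w|²`), and
   `|∫⟪(w·∇)u', w⟫| ≤ ‖∇u'‖₂ ‖w‖²_{L⁴} ≤ ‖∇u'‖₂ ‖w‖₂^{1/2} (K‖∇w‖₂)^{3/2}` (interpolation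
   `integral_norm_pow_four_le` and the Sobolev inequality `eLpNorm_six_le_eLpNorm_fderiv_two`) is
   absorbed by Young's inequality (`mul_rpow_mul_rpow_le_absorb`, `θ = 1/4`):
   `2∫⟪w, ∂ₜw⟫ ≤ C ν⁻³ (∫|∇u'|²)² ∫|w|²`.
3. **Grönwall** with the constant rate `C ν⁻³ S²` (`le_mul_exp_of_le_add_mul_integral`).

## References

* J. C. Robinson, J. L. Rodrigo, W. Sadowski, *The Three-Dimensional Navier–Stokes Equations*,
  CUP 2016, Thm. 6.10 (proof, PDF p. 106) and (6.3). [RobinsonRodrigoSadowski2016]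
* T. Tao, Anal. PDE 6 (2013) = arXiv:1108.1165, Thm. 5.4 (v). [Tao2011]
-/

noncomputable section

open MeasureTheory Set Function Filter Topology InnerProductSpace
open scoped ENNReal NNReal ContDiff RealInnerProductSpace Laplacian

namespace Literature.Analysis.FluidPDE

/-! ### The `L²` balance of a jointly smooth field on a slab -/

section Balance

/-- **The `L²` balance on a closed slab**: for `w` jointly smooth on `[0, T] × ℝ³` with
`∫‖w(t)‖² ≤ C₀` and `∫‖∂ₜw(t)‖² ≤ C₁` on `[0, T]` (`∂ₜw` the one-sided time derivative within
`[0, T]`), with `E(t) = ∫ ‖w(t)‖²` and `Φ(t) = ∫ 2⟪w(t), ∂ₜw(t)⟫`: `Φ` is integrable on `(0, T)`,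
`E` is continuous on `[0, T]`, and `E(b) = E(0) + ∫₀ᵇ Φ` for `b ∈ (0, T]` (pointwise
`d/dt ‖w(t,x)‖² = 2⟪w, ∂ₜw⟫` at interior times, the fundamental theorem of calculus in `t` for each
`x`, and Fubini). The order-zero twin of `IsSmoothSpaceTimeOn.enstrophy_balance`. [folklore] -/
theorem IsSmoothSpaceTimeOn.l2_balance {T : ℝ} (hT : 0 < T)
    {w : ℝ → EuclideanSpace ℝ (Fin 3) → EuclideanSpace ℝ (Fin 3)}
    (hw : FluidPDE.IsSmoothSpaceTimeOn (Icc 0 T) w) {C₀ C₁ : ℝ≥0}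
    (hC₀ : ∀ t ∈ Icc 0 T, ∫⁻ x, ‖w t x‖ₑ ^ 2 ≤ C₀)
    (hC₁ : ∀ t ∈ Icc 0 T, ∫⁻ x, ‖FluidPDE.timeDerivWithin (Icc 0 T) w t x‖ₑ ^ 2 ≤ C₁) :
    IntegrableOn (fun t => ∫ x, 2 * ⟪w t x, FluidPDE.timeDerivWithin (Icc 0 T) w t x⟫) (Ioo 0 T) ∧
    ContinuousOn (fun t => ∫ x, ‖w t x‖ ^ 2) (Icc 0 T) ∧
    ∀ b ∈ Ioc 0 T, ∫ x, ‖w b x‖ ^ 2 =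
      (∫ x, ‖w 0 x‖ ^ 2) + ∫ t in (0 : ℝ)..b, ∫ x, 2 * ⟪w t x, FluidPDE.timeDerivWithin (Icc 0 T) w t x⟫ := by
  have hU : UniqueDiffOn ℝ (Icc 0 T) := uniqueDiffOn_Icc hT
  set W : ℝ → EuclideanSpace ℝ (Fin 3) → EuclideanSpace ℝ (Fin 3) :=
    FluidPDE.timeDerivWithin (Icc 0 T) w with hW
  have hWsm : FluidPDE.IsSmoothSpaceTimeOn (Icc 0 T) W := hw.timeDerivWithin hU
  have cw : ContinuousOn (uncurry w) (Icc 0 T ×ˢ univ) := hw.continuousOn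
  have cW : ContinuousOn (uncurry W) (Icc 0 T ×ˢ univ) := hWsm.continuousOn
  -- the density `g t x = ⟪w, W⟫` and the energy `E t = ∫ ‖w(t)‖²` (opaque, with equations)
  obtain ⟨g, hg⟩ : ∃ g : ℝ → EuclideanSpace ℝ (Fin 3) → ℝ, g = fun t x => ⟪w t x, W t x⟫ :=
    ⟨_, rfl⟩
  obtain ⟨E, hE⟩ : ∃ E : ℝ → ℝ, E = fun t => ∫ x, ‖w t x‖ ^ 2 := ⟨_, rfl⟩
  have hgt : ∀ t x, g t x = ⟪w t x, W t x⟫ := fun t x => by rw [hg]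
  have hEt : ∀ t, E t = ∫ x, ‖w t x‖ ^ 2 := fun t => by rw [hE]
  have cg : ContinuousOn (uncurry g) (Icc 0 T ×ˢ univ) := by
    rw [hg]; exact cw.inner cW
  have csq : ContinuousOn (fun z : ℝ × EuclideanSpace ℝ (Fin 3) => ‖w z.1 z.2‖ ^ 2)
      (Icc 0 T ×ˢ univ) := (cw.norm).pow 2
  -- slices
  have cwt : ∀ t ∈ Icc 0 T, Continuous (w t) := fun t ht => (hw.contDiff_slice ht).continuous
  have cWt : ∀ t ∈ Icc 0 T, Continuous (W t) := fun t ht => (hWsm.contDiff_slice ht).continuous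
  have hw_lt : ∀ t ∈ Icc 0 T, ∫⁻ x, ‖w t x‖ₑ ^ 2 < ⊤ := fun t ht =>
    (hC₀ t ht).trans_lt ENNReal.coe_lt_top
  have hW_lt : ∀ t ∈ Icc 0 T, ∫⁻ x, ‖W t x‖ₑ ^ 2 < ⊤ := fun t ht =>
    (hC₁ t ht).trans_lt ENNReal.coe_lt_top
  have isq : ∀ t ∈ Icc 0 T, Integrable (fun x => ‖w t x‖ ^ 2) volume := fun t ht =>
    FluidPDE.integrable_sq_norm_of_lintegral_lt_top (cwt t ht) (hw_lt t ht)
  -- pointwise bound `|g| ≤ (‖w‖² + ‖W‖²)/2` and integrability of `g` on `(0, T) × ℝ³`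
  have hgle : ∀ t x, ‖g t x‖ ≤ 2⁻¹ * (‖w t x‖ ^ 2 + ‖W t x‖ ^ 2) := by
    intro t x
    rw [hgt]
    refine (norm_inner_le_norm (𝕜 := ℝ) _ _).trans ?_
    nlinarith [sq_nonneg (‖w t x‖ - ‖W t x‖)]
  have hg_lint : ∀ t ∈ Icc 0 T, ∫⁻ x, ‖g t x‖ₑ ≤ 2⁻¹ * (C₀ + C₁) := by
    intro t ht
    have h2 : (2⁻¹ : ℝ≥0∞) = ENNReal.ofReal 2⁻¹ := by
      rw [ENNReal.ofReal_inv_of_pos zero_lt_two, ENNReal.ofReal_ofNat]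
    have hpt : ∀ x, ‖g t x‖ₑ ≤ (2⁻¹ : ℝ≥0∞) * (‖w t x‖ₑ ^ 2 + ‖W t x‖ₑ ^ 2) := by
      intro x
      have hR : (2⁻¹ : ℝ≥0∞) * (‖w t x‖ₑ ^ 2 + ‖W t x‖ₑ ^ 2) =
          ENNReal.ofReal (2⁻¹ * (‖w t x‖ ^ 2 + ‖W t x‖ ^ 2)) := by
        rw [ENNReal.ofReal_mul (by norm_num), ENNReal.ofReal_add (sq_nonneg _) (sq_nonneg _),
          ENNReal.ofReal_pow (norm_nonneg _), ENNReal.ofReal_pow (norm_nonneg _), ofReal_norm,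
          ofReal_norm, h2]
      rw [hR, ← ofReal_norm]
      exact ENNReal.ofReal_le_ofReal (hgle t x)
    calc ∫⁻ x, ‖g t x‖ₑ ≤ ∫⁻ x, (2⁻¹ : ℝ≥0∞) * (‖w t x‖ₑ ^ 2 + ‖W t x‖ₑ ^ 2) := lintegral_mono hpt
      _ = (2⁻¹ : ℝ≥0∞) * ((∫⁻ x, ‖w t x‖ₑ ^ 2) + ∫⁻ x, ‖W t x‖ₑ ^ 2) := by
          rw [lintegral_const_mul' _ _ (by simp), lintegral_add_left']
          exact (cwt t ht).aemeasurable.enorm.pow_const _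
      _ ≤ 2⁻¹ * (C₀ + C₁) := by
          gcongr
          · exact hC₀ t ht
          · exact hC₁ t ht
  have hKfin : (2⁻¹ : ℝ≥0∞) * (C₀ + C₁) ≠ ⊤ :=
    ENNReal.mul_ne_top (by simp) (ENNReal.add_ne_top.2 ⟨ENNReal.coe_ne_top, ENNReal.coe_ne_top⟩)
  have hg_int : ∀ b ∈ Ioc 0 T, Integrable (uncurry g)
      (((volume : Measure ℝ).restrict (Ioo 0 b)).prod volume) := by
    intro b hb
    refine FluidPDE.integrable_prod_of_continuousOn_of_lintegral
      (cg.mono (prod_mono (Icc_subset_Icc le_rfl hb.2) Subset.rfl)) ?_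
    calc ∫⁻ t in Ioo 0 b, ∫⁻ x, ‖uncurry g (t, x)‖ₑ
        ≤ ∫⁻ _ in Ioo 0 b, (2⁻¹ : ℝ≥0∞) * (C₀ + C₁) :=
          setLIntegral_mono' measurableSet_Ioo fun t ht =>
            hg_lint t ⟨ht.1.le, ht.2.le.trans hb.2⟩
      _ < ⊤ := by
          rw [setLIntegral_const]
          exact ENNReal.mul_lt_top hKfin.lt_top (by simp)
  -- the time derivative of `‖w(t, x)‖²` at interior times
  have hderiv : ∀ t ∈ Ioo 0 T, ∀ x, HasDerivAt (fun τ => ‖w τ x‖ ^ 2) (2 * g t x) t := by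
    intro t ht x
    have h1 : HasDerivAt (fun τ => w τ x) (W t x) t :=
      (hw.hasDerivWithinAt_timeDerivWithin hU (Ioo_subset_Icc_self ht) x).hasDerivAt
        (Icc_mem_nhds ht.1 ht.2)
    have h2 := h1.norm_sq
    rw [hgt]
    exact h2
  -- FTC in `t` for each `x`, on `[0, b]`
  have hFTC : ∀ b ∈ Ioc 0 T, ∀ x, ∫ t in (0 : ℝ)..b, 2 * g t x = ‖w b x‖ ^ 2 - ‖w 0 x‖ ^ 2 := by
    intro b hb x
    have hsub : Icc 0 b ⊆ Icc 0 T := Icc_subset_Icc le_rfl hb.2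
    have hc : ContinuousOn (fun τ => ((τ, x) : ℝ × EuclideanSpace ℝ (Fin 3))) (Icc 0 b) :=
      (continuous_id.prodMk continuous_const).continuousOn
    have hmaps : MapsTo (fun τ => ((τ, x) : ℝ × EuclideanSpace ℝ (Fin 3))) (Icc 0 b)
        (Icc 0 T ×ˢ univ) := fun τ hτ => mk_mem_prod (hsub hτ) (mem_univ x)
    have hcont : ContinuousOn (fun τ => ‖w τ x‖ ^ 2) (Icc 0 b) :=
      (csq.comp hc hmaps).congr fun τ _ => rfl
    have hcg : ContinuousOn (fun τ => g τ x) (Icc 0 b) := (cg.comp hc hmaps).congr fun τ _ => rfl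
    have hcont' : ContinuousOn (fun τ => 2 * g τ x) (Icc 0 b) := continuousOn_const.mul hcg
    exact intervalIntegral.integral_eq_sub_of_hasDerivAt_of_le (f := fun τ => ‖w τ x‖ ^ 2)
      (f' := fun τ => 2 * g τ x) hb.1.le hcont (fun t ht => hderiv t ⟨ht.1, ht.2.trans_le hb.2⟩ x)
      (hcont'.intervalIntegrable_of_Icc hb.1.le)
  -- Fubini: `E b - E 0 = ∫₀ᵇ ∫ 2 g`
  obtain ⟨φ, hφ⟩ : ∃ φ : ℝ → ℝ, φ = fun t => ∫ x, 2 * g t x := ⟨_, rfl⟩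
  have hφt : ∀ t, φ t = ∫ x, 2 * g t x := fun t => by rw [hφ]
  have hφ_int : IntegrableOn φ (Ioo 0 T) volume := by
    rw [hφ]; exact ((hg_int T ⟨hT, le_rfl⟩).const_mul 2).integral_prod_left
  have hEb : ∀ b ∈ Ioc 0 T, E b = E 0 + ∫ t in (0 : ℝ)..b, φ t := by
    intro b hb
    have hI := (hg_int b hb).const_mul 2
    have hswap := integral_integral_swap (μ := (volume : Measure ℝ).restrict (Ioo 0 b))
      (ν := (volume : Measure (EuclideanSpace ℝ (Fin 3)))) (f := fun t x => 2 * g t x) hI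
    have hx : ∫ x, ∫ t in Ioo 0 b, 2 * g t x = E b - E 0 := by
      have : (fun x => ∫ t in Ioo 0 b, 2 * g t x) = fun x => ‖w b x‖ ^ 2 - ‖w 0 x‖ ^ 2 := by
        funext x
        rw [← hFTC b hb x, intervalIntegral.integral_of_le hb.1.le, integral_Ioc_eq_integral_Ioo]
      rw [this, integral_sub (isq b ⟨hb.1.le, hb.2⟩) (isq 0 ⟨le_rfl, hT.le⟩), hEt, hEt]
    rw [intervalIntegral.integral_of_le hb.1.le, integral_Ioc_eq_integral_Ioo]
    simp only [hφt]
    rw [hswap, hx]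
    ring
  -- continuity of `E` on `[0, T]`
  have hEcont : ContinuousOn E (Icc 0 T) := by
    have hprim : ContinuousOn (fun b => ∫ t in (0 : ℝ)..b, φ t) (Icc 0 T) := by
      have h := intervalIntegral.continuousOn_primitive_interval (μ := volume) (f := φ) (a := 0)
        (b := T) (by
          rw [uIcc_of_le hT.le]
          exact (hφ_int.congr_set_ae Ioo_ae_eq_Icc.symm))
      rwa [uIcc_of_le hT.le] at h
    have heq : ∀ b ∈ Icc 0 T, E b = E 0 + ∫ t in (0 : ℝ)..b, φ t := by
      intro b hb
      rcases eq_or_lt_of_le hb.1 with h | h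
      · rw [← h]; simp
      · exact hEb b ⟨h, hb.2⟩
    exact (continuousOn_const.add hprim).congr heq
  refine ⟨?_, ?_, fun b hb => ?_⟩
  · refine hφ_int.congr_fun (fun t _ => ?_) measurableSet_Ioo
    rw [hφt]
    refine integral_congr_ae (Eventually.of_forall fun x => ?_)
    simp only [hgt]
  · rw [hE] at hEcont
    exact hEcont
  · have h := hEb b hb
    rw [hEt, hEt] at h
    rw [h]
    congr 1
    refine intervalIntegral.integral_congr fun t _ => ?_
    rw [hφt]
    refine integral_congr_ae (Eventually.of_forall fun x => ?_)
    simp only [hgt]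

end Balance

/-! ### Real-analysis helpers -/

section Real

/-- `∫⁻ ‖g‖ₑ⁶ = ‖g‖⁶_{L⁶}`. [folklore] -/
theorem lintegral_enorm_pow_six_eq_eLpNorm_pow {α : Type*} [MeasurableSpace α] (μ : Measure α)
    {G : Type*} [NormedAddCommGroup G] (g : α → G) : ∫⁻ x, ‖g x‖ₑ ^ 6 ∂μ = eLpNorm g 6 μ ^ 6 := by
  have h := eLpNorm_nnreal_pow_eq_lintegral (f := g) (μ := μ) (p := (6 : ℝ≥0)) (by norm_num)
  simp only [ENNReal.coe_ofNat, NNReal.coe_ofNat, ENNReal.rpow_ofNat] at h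
  exact h.symm

/-- Elementary exponent bookkeeping: from `P ≤ √E √Q` and `Q ≤ K⁶ D³` (all nonnegative),
`√P ≤ K^{3/2} E^{1/4} D^{3/4}`. [folklore] -/
theorem sqrt_le_of_interp_sobolev {P E Q K D : ℝ} (hE : 0 ≤ E) (hK : 0 ≤ K) (hD : 0 ≤ D) (h1 : P ≤ Real.sqrt E * Real.sqrt Q) (h2 : Q ≤ K ^ 6 * D ^ 3) :
    Real.sqrt P ≤ K ^ (3 / 2 : ℝ) * E ^ (1 / 4 : ℝ) * D ^ (3 / 4 : ℝ) := by
  have h3 : Real.sqrt Q ≤ K ^ 3 * D ^ (3 / 2 : ℝ) := by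
    calc Real.sqrt Q ≤ Real.sqrt (K ^ 6 * D ^ 3) := Real.sqrt_le_sqrt h2
      _ = K ^ 3 * D ^ (3 / 2 : ℝ) := by
          rw [Real.sqrt_eq_rpow, Real.mul_rpow (by positivity) (by positivity),
            ← Real.rpow_natCast K 6, ← Real.rpow_mul hK, ← Real.rpow_natCast D 3,
            ← Real.rpow_mul hD]
          norm_num
  have h4 : P ≤ Real.sqrt E * (K ^ 3 * D ^ (3 / 2 : ℝ)) :=
    h1.trans (mul_le_mul_of_nonneg_left h3 (Real.sqrt_nonneg _))
  calc Real.sqrt P ≤ Real.sqrt (Real.sqrt E * (K ^ 3 * D ^ (3 / 2 : ℝ))) := Real.sqrt_le_sqrt h4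
    _ = K ^ (3 / 2 : ℝ) * E ^ (1 / 4 : ℝ) * D ^ (3 / 4 : ℝ) := by
        rw [Real.sqrt_eq_rpow, Real.sqrt_eq_rpow, Real.mul_rpow (by positivity) (by positivity),
          Real.mul_rpow (by positivity) (by positivity), ← Real.rpow_mul hE,
          ← Real.rpow_natCast K 3, ← Real.rpow_mul hK, ← Real.rpow_mul hD]
        norm_num
        ring

end Real

/-! ### The `L²` production bound for the difference of two solutions, one time slice -/

section Slice

set_option maxHeartbeats 800000 in
/-- **The difference inequality, one time slice** (Robinson–Rodrigo–Sadowski 2016, proof of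
Thm. 6.10: `½ d/dt‖w‖² + ν‖∇w‖² ≤ |⟨(w·∇)u, w⟩| ≤ c‖∇u‖‖w‖^{1/2}‖∇w‖^{3/2}
≤ c ν⁻³‖∇u‖⁴‖w‖² + ν/2 ‖∇w‖²` on the whole space, with the Sobolev inequality `H¹ ⊂ L⁶` in place
of (6.6)). There is an absolute constant `C ≥ 0` such that: if `v, v' : ℝ³ → ℝ³` are `C²`,
divergence free and bounded, `W₁, W₂ : ℝ³ → ℝ³`, `q₁, q₂ : ℝ³ → ℝ` are `C¹` with the momentum
equations `Wᵢ + (vᵢ·∇)vᵢ = νΔvᵢ − ∇qᵢ` (`ν > 0`), and `vᵢ, Dvᵢ, D²vᵢ, Wᵢ, qᵢ, Dqᵢ ∈ L²`, then,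
with `w = v − v'`,
`2∫⟪w, W₁ − W₂⟫ ≤ C ν⁻³ (∫|∇v'|²)² ∫‖w‖²`.
Proof: `W₁ − W₂ = νΔw − ∇(q₁ − q₂) − (v·∇)w − (w·∇)v'`; the diffusion term is `−ν∫|∇w|²`
(`integral_sum_inner_fderiv_fderiv_eq_neg_integral_inner_laplacian`), the pressure and transport
terms vanish (`integral_inner_gradient_eq_zero_of_isDivFree_R3`,
`integral_inner_weakGrad_apply_self_eq_zero`), and the stretching term is bounded by
`‖∇v'‖₂‖w‖²_{L⁴} ≤ ‖∇v'‖₂ ‖w‖₂^{1/2} (K‖∇w‖₂)^{3/2}` (`integral_norm_pow_four_le`,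
`eLpNorm_six_le_eLpNorm_fderiv_two`) and absorbed (`mul_rpow_mul_rpow_le_absorb`, `θ = 1/4`).
(One long computation; the heartbeat budget is raised for this declaration only.) [cite: RobinsonRodrigoSadowski2016, Thm. 6.10 (proof)] -/
theorem exists_l2_slice :
    ∃ C : ℝ, 0 ≤ C ∧ ∀ ⦃ν : ℝ⦄ (_ : 0 < ν)
      ⦃v v' W₁ W₂ : EuclideanSpace ℝ (Fin 3) → EuclideanSpace ℝ (Fin 3)⦄
      ⦃q₁ q₂ : EuclideanSpace ℝ (Fin 3) → ℝ⦄
      (_ : ContDiff ℝ 2 v) (_ : ContDiff ℝ 2 v') (_ : ContDiff ℝ 1 W₁) (_ : ContDiff ℝ 1 W₂)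
      (_ : ContDiff ℝ 1 q₁) (_ : ContDiff ℝ 1 q₂)
      (_ : ∀ x, W₁ x + FluidPDE.convect v v x = ν • (Δ v) x - gradient q₁ x)
      (_ : ∀ x, W₂ x + FluidPDE.convect v' v' x = ν • (Δ v') x - gradient q₂ x)
      (_ : VectorCalculus.IsDivFree v) (_ : VectorCalculus.IsDivFree v')
      ⦃B : ℝ⦄ (_ : ∀ x, ‖v x‖ ≤ B) (_ : ∀ x, ‖v' x‖ ≤ B)
      (_ : ∫⁻ x, ‖v x‖ₑ ^ 2 < ⊤) (_ : ∫⁻ x, ‖iteratedFDeriv ℝ 1 v x‖ₑ ^ 2 < ⊤)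
      (_ : ∫⁻ x, ‖iteratedFDeriv ℝ 2 v x‖ₑ ^ 2 < ⊤)
      (_ : ∫⁻ x, ‖v' x‖ₑ ^ 2 < ⊤) (_ : ∫⁻ x, ‖iteratedFDeriv ℝ 1 v' x‖ₑ ^ 2 < ⊤)
      (_ : ∫⁻ x, ‖iteratedFDeriv ℝ 2 v' x‖ₑ ^ 2 < ⊤)
      (_ : ∫⁻ x, ‖W₁ x‖ₑ ^ 2 < ⊤) (_ : ∫⁻ x, ‖W₂ x‖ₑ ^ 2 < ⊤)
      (_ : ∫⁻ x, ‖q₁ x‖ₑ ^ 2 < ⊤) (_ : ∫⁻ x, ‖iteratedFDeriv ℝ 1 q₁ x‖ₑ ^ 2 < ⊤)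
      (_ : ∫⁻ x, ‖q₂ x‖ₑ ^ 2 < ⊤) (_ : ∫⁻ x, ‖iteratedFDeriv ℝ 1 q₂ x‖ₑ ^ 2 < ⊤),
      2 * ∫ x, ⟪v x - v' x, W₁ x - W₂ x⟫ ≤
        C * (ν ^ 3)⁻¹ * (∫ x, FluidPDE.frobeniusNormSq (fderiv ℝ v' x)) ^ 2 *
          ∫ x, ‖v x - v' x‖ ^ 2 := by
  set K : ℝ≥0 := SNormLESNormFDerivOfEqConst (EuclideanSpace ℝ (Fin 3))
    (volume : Measure (EuclideanSpace ℝ (Fin 3))) 2 with hK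
  set θ : ℝ := 1 / 4 with hθdef
  set C₀ : ℝ := θ * (2 * (1 - θ)) ^ ((1 - θ) / θ) with hC₀
  have hθ0 : 0 < θ := by norm_num [hθdef]
  have hθ1 : θ < 1 := by norm_num [hθdef]
  have h1θ : 0 ≤ 1 - θ := by norm_num [hθdef]
  have hC₀0 : 0 ≤ C₀ := by positivity
  refine ⟨2 * C₀ * (K : ℝ) ^ 6, by positivity, ?_⟩
  intro ν hν v v' W₁ W₂ q₁ q₂ hv hv' hW₁ hW₂ hq₁ hq₂ hmom₁ hmom₂ hdiv hdiv' B hB hB' hv0 hv1 hv2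
    hv'0 hv'1 hv'2 hW₁0 hW₂0 hq₁0 hq₁1 hq₂0 hq₂1
  set e := EuclideanSpace.basisFun (Fin 3) ℝ with he
  have he1 : ∀ i, ‖e i‖ = 1 := fun i => by simp [he]
  have hB0 : 0 ≤ B := (norm_nonneg _).trans (hB 0)
  -- the differences `w = v - v'`, `W = W₁ - W₂`, `π = q₁ - q₂` (opaque, with equations)
  obtain ⟨w, hwdef⟩ : ∃ w : EuclideanSpace ℝ (Fin 3) → EuclideanSpace ℝ (Fin 3),
      w = fun x => v x - v' x := ⟨_, rfl⟩
  obtain ⟨W, hWdef⟩ : ∃ W : EuclideanSpace ℝ (Fin 3) → EuclideanSpace ℝ (Fin 3),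
      W = fun x => W₁ x - W₂ x := ⟨_, rfl⟩
  obtain ⟨π, hπdef⟩ : ∃ π : EuclideanSpace ℝ (Fin 3) → ℝ, π = fun x => q₁ x - q₂ x := ⟨_, rfl⟩
  have hwx : ∀ x, w x = v x - v' x := fun x => by rw [hwdef]
  have hWx : ∀ x, W x = W₁ x - W₂ x := fun x => by rw [hWdef]
  have hπx : ∀ x, π x = q₁ x - q₂ x := fun x => by rw [hπdef]
  have hw : ContDiff ℝ 2 w := by rw [hwdef]; exact hv.sub hv'
  have hw1 : ContDiff ℝ 1 w := hw.of_le (by norm_num)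
  have hW : ContDiff ℝ 1 W := by rw [hWdef]; exact hW₁.sub hW₂
  have hπ : ContDiff ℝ 1 π := by rw [hπdef]; exact hq₁.sub hq₂
  have hdv : Differentiable ℝ v := hv.differentiable (by norm_num)
  have hdv' : Differentiable ℝ v' := hv'.differentiable (by norm_num)
  have hdw : Differentiable ℝ w := hw1.differentiable one_ne_zero
  have hdq₁ : Differentiable ℝ q₁ := hq₁.differentiable one_ne_zero
  have hdq₂ : Differentiable ℝ q₂ := hq₂.differentiable one_ne_zero
  have hfdw : ∀ x, fderiv ℝ w x = fderiv ℝ v x - fderiv ℝ v' x := fun x => by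
    rw [hwdef]; exact fderiv_fun_sub (hdv x) (hdv' x)
  have hΔw : ∀ x, (Δ w) x = (Δ v) x - (Δ v') x := fun x => by
    have h := hv.contDiffAt.laplacian_sub hv'.contDiffAt (x := x)
    rw [hwdef]
    exact h
  have hgradπ : ∀ x, gradient π x = gradient q₁ x - gradient q₂ x := fun x => by
    rw [hπdef, gradient, gradient, gradient, fderiv_fun_sub (hdq₁ x) (hdq₂ x), map_sub]
  have hdivw : VectorCalculus.IsDivFree w := by
    intro x
    rw [FluidPDE.divergence_eq_traceCLM, hfdw x, map_sub, ← FluidPDE.divergence_eq_traceCLM,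
      ← FluidPDE.divergence_eq_traceCLM, hdiv x, hdiv' x, sub_zero]
  -- the momentum equation of the difference
  have hmom : ∀ x, W x = ν • (Δ w) x - gradient π x - FluidPDE.convect v w x - FluidPDE.convect w v' x := by
    intro x
    have h1 := hmom₁ x
    have h2 := hmom₂ x
    have hc : FluidPDE.convect v v x - FluidPDE.convect v' v' x =
        FluidPDE.convect v w x + FluidPDE.convect w v' x := by
      simp only [FluidPDE.convect, hfdw x, hwx x, FunLike.coe_sub, Pi.sub_apply, map_sub]
      abel
    have h1' : W₁ x = ν • (Δ v) x - gradient q₁ x - FluidPDE.convect v v x := eq_sub_of_add_eq h1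
    have h2' : W₂ x = ν • (Δ v') x - gradient q₂ x - FluidPDE.convect v' v' x := eq_sub_of_add_eq h2
    rw [hWx, h1', h2', hΔw, hgradπ, smul_sub]
    have : FluidPDE.convect v v x = FluidPDE.convect v' v' x +
        (FluidPDE.convect v w x + FluidPDE.convect w v' x) := by rw [← hc]; abel
    rw [this]
    abel
  -- continuity
  have cv : Continuous v := hv.continuous
  have cv' : Continuous v' := hv'.continuous
  have cw : Continuous w := hw.continuous
  have cDv : Continuous (fderiv ℝ v) := hv.continuous_fderiv (by norm_num)
  have cDv' : Continuous (fderiv ℝ v') := hv'.continuous_fderiv (by norm_num)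
  have cDw : Continuous (fderiv ℝ w) := hw.continuous_fderiv (by norm_num)
  have cD2v : Continuous fun x => iteratedFDeriv ℝ 2 v x := hv.continuous_iteratedFDeriv le_rfl
  have cD2v' : Continuous fun x => iteratedFDeriv ℝ 2 v' x := hv'.continuous_iteratedFDeriv le_rfl
  have cD2w : Continuous fun x => iteratedFDeriv ℝ 2 w x := hw.continuous_iteratedFDeriv le_rfl
  have cW₁ : Continuous W₁ := hW₁.continuous
  have cW : Continuous W := hW.continuous
  have cq₁ : Continuous q₁ := hq₁.continuous
  have cπ : Continuous π := hπ.continuous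
  have cDq₁ : Continuous (fderiv ℝ q₁) := hq₁.continuous_fderiv one_ne_zero
  have cDq₂ : Continuous (fderiv ℝ q₂) := hq₂.continuous_fderiv one_ne_zero
  have cDπ : Continuous (fderiv ℝ π) := hπ.continuous_fderiv one_ne_zero
  have hΔ1 : ContDiff ℝ 0 (Δ w) := by
    have h : Δ w = fun y => ∑ i, fderiv ℝ (fun z => fderiv ℝ w z (e i)) y (e i) :=
      funext fun y => FluidPDE.laplacian_eq_sum_fderiv_fderiv e hw y
    rw [h]
    exact ContDiff.sum fun i _ =>
      ((hw.fderiv_right (m := 1) (by norm_num)).clm_apply contDiff_const).fderiv_right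
        (m := 0) (by norm_num) |>.clm_apply contDiff_const
  have cΔ : Continuous (Δ w) := hΔ1.continuous
  have cdiw : ∀ i, Continuous fun x => fderiv ℝ w x (e i) := fun i => cDw.clm_apply continuous_const
  have cddw : ∀ i, Continuous fun x => fderiv ℝ (fun y => fderiv ℝ w y (e i)) x (e i) := fun i =>
    ((((hw.fderiv_right (m := 1) (by norm_num)).clm_apply contDiff_const).continuous_fderiv
      (by norm_num)).clm_apply continuous_const)
  have cdiπ : ∀ i, Continuous fun x => fderiv ℝ π x (e i) := fun i => cDπ.clm_apply continuous_const
  have cgπ : Continuous (gradient π) := by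
    have : gradient π = fun x => (InnerProductSpace.toDual ℝ _).symm (fderiv ℝ π x) := rfl
    rw [this]
    exact (InnerProductSpace.toDual ℝ (EuclideanSpace ℝ (Fin 3))).symm.continuous.comp cDπ
  -- pointwise bounds
  have hwB : ∀ x, ‖w x‖ ≤ 2 * B := fun x => by
    rw [hwx]; exact (norm_sub_le _ _).trans (by linarith [hB x, hB' x])
  have hDv_eq : ∀ x, ‖fderiv ℝ v x‖ = ‖iteratedFDeriv ℝ 1 v x‖ := fun x => by
    rw [← norm_iteratedFDeriv_fderiv, norm_iteratedFDeriv_zero]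
  have hDv'_eq : ∀ x, ‖fderiv ℝ v' x‖ = ‖iteratedFDeriv ℝ 1 v' x‖ := fun x => by
    rw [← norm_iteratedFDeriv_fderiv, norm_iteratedFDeriv_zero]
  have hD2w : ∀ x, iteratedFDeriv ℝ 2 w x = iteratedFDeriv ℝ 2 v x - iteratedFDeriv ℝ 2 v' x :=
    fun x => by rw [hwdef]; exact fun_iteratedFDeriv_sub_apply hv.contDiffAt hv'.contDiffAt
  have n_Δ : ∀ x, ‖(Δ w) x‖ ≤ ‖(3 : ℝ) • iteratedFDeriv ℝ 2 w x‖ := fun x => by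
    rw [norm_smul, Real.norm_of_nonneg (by norm_num : (0 : ℝ) ≤ 3)]
    exact norm_laplacian_le_three_mul_norm_iteratedFDeriv_two hw x
  have n_gπ : ∀ x, ‖gradient π x‖ = ‖fderiv ℝ π x‖ := fun x => by
    rw [gradient, LinearIsometryEquiv.norm_map]
  have hfdπ : ∀ x, fderiv ℝ π x = fderiv ℝ q₁ x - fderiv ℝ q₂ x := fun x => by
    rw [hπdef]; exact fderiv_fun_sub (hdq₁ x) (hdq₂ x)
  have hDq₁_eq : ∀ x, ‖fderiv ℝ q₁ x‖ = ‖iteratedFDeriv ℝ 1 q₁ x‖ := fun x => by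
    rw [← norm_iteratedFDeriv_fderiv, norm_iteratedFDeriv_zero]
  have hDq₂_eq : ∀ x, ‖fderiv ℝ q₂ x‖ = ‖iteratedFDeriv ℝ 1 q₂ x‖ := fun x => by
    rw [← norm_iteratedFDeriv_fderiv, norm_iteratedFDeriv_zero]
  have hin : ∀ i (y : EuclideanSpace ℝ (Fin 3)), ‖⟪e i, y⟫‖ ≤ ‖y‖ := fun i y =>
    (norm_inner_le_norm (𝕜 := ℝ) (e i) y).trans (by rw [he1, one_mul])
  -- finite `L²` norms
  have l2w : ∫⁻ x, ‖w x‖ₑ ^ 2 < ⊤ := by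
    refine lintegral_enorm_sq_lt_top_of_norm_le_add (fun x => ?_) cv.aestronglyMeasurable hv0 hv'0
    rw [hwx]; exact norm_sub_le _ _
  have l2Dv : ∫⁻ x, ‖fderiv ℝ v x‖ₑ ^ 2 < ⊤ :=
    lintegral_enorm_sq_lt_top_of_norm_le (fun x => (hDv_eq x).le) hv1
  have l2Dv' : ∫⁻ x, ‖fderiv ℝ v' x‖ₑ ^ 2 < ⊤ :=
    lintegral_enorm_sq_lt_top_of_norm_le (fun x => (hDv'_eq x).le) hv'1
  have l2Dw : ∫⁻ x, ‖fderiv ℝ w x‖ₑ ^ 2 < ⊤ := by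
    refine lintegral_enorm_sq_lt_top_of_norm_le_add (fun x => ?_) cDv.aestronglyMeasurable l2Dv l2Dv'
    rw [hfdw]; exact norm_sub_le _ _
  have l2D2w : ∫⁻ x, ‖iteratedFDeriv ℝ 2 w x‖ₑ ^ 2 < ⊤ := by
    refine lintegral_enorm_sq_lt_top_of_norm_le_add (fun x => ?_) cD2v.aestronglyMeasurable hv2 hv'2
    rw [hD2w]; exact norm_sub_le _ _
  have l2Δ : ∫⁻ x, ‖(Δ w) x‖ₑ ^ 2 < ⊤ :=
    lintegral_enorm_sq_lt_top_of_norm_le n_Δ (lintegral_enorm_sq_const_smul_lt_top 3 l2D2w)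
  have l2W : ∫⁻ x, ‖W x‖ₑ ^ 2 < ⊤ := by
    refine lintegral_enorm_sq_lt_top_of_norm_le_add (fun x => ?_) cW₁.aestronglyMeasurable hW₁0 hW₂0
    rw [hWx]; exact norm_sub_le _ _
  have l2π : ∫⁻ x, ‖π x‖ₑ ^ 2 < ⊤ := by
    refine lintegral_enorm_sq_lt_top_of_norm_le_add (fun x => ?_) cq₁.aestronglyMeasurable hq₁0 hq₂0
    rw [hπx]; exact norm_sub_le _ _
  have l2Dπ : ∫⁻ x, ‖fderiv ℝ π x‖ₑ ^ 2 < ⊤ := by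
    refine lintegral_enorm_sq_lt_top_of_norm_le_add (fun x => ?_) cDq₁.aestronglyMeasurable
      (lintegral_enorm_sq_lt_top_of_norm_le (fun x => (hDq₁_eq x).le) hq₁1)
      (lintegral_enorm_sq_lt_top_of_norm_le (fun x => (hDq₂_eq x).le) hq₂1)
    rw [hfdπ]; exact norm_sub_le _ _
  have l2gπ : ∫⁻ x, ‖gradient π x‖ₑ ^ 2 < ⊤ :=
    lintegral_enorm_sq_lt_top_of_norm_le (fun x => (n_gπ x).le) l2Dπ
  have l2diw : ∀ i, ∫⁻ x, ‖fderiv ℝ w x (e i)‖ₑ ^ 2 < ⊤ := fun i =>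
    lintegral_enorm_sq_lt_top_of_norm_le (fun x => by
      simpa [he1] using (fderiv ℝ w x).le_opNorm (e i)) l2Dw
  have l2ddw : ∀ i, ∫⁻ x, ‖fderiv ℝ (fun y => fderiv ℝ w y (e i)) x (e i)‖ₑ ^ 2 < ⊤ := fun i =>
    lintegral_enorm_sq_lt_top_of_norm_le (fun x => norm_fderiv_fderiv_apply_basisFun_le hw x i) l2D2w
  have l2diπ : ∀ i, ∫⁻ x, ‖fderiv ℝ π x (e i)‖ₑ ^ 2 < ⊤ := fun i =>
    lintegral_enorm_sq_lt_top_of_norm_le (fun x => by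
      simpa [he1] using (fderiv ℝ π x).le_opNorm (e i)) l2Dπ
  have l2conv₁ : ∫⁻ x, ‖FluidPDE.convect v w x‖ₑ ^ 2 < ⊤ := by
    have hb : ∫⁻ x, ‖B * ‖fderiv ℝ w x‖‖ₑ ^ 2 < ⊤ := by
      have h := lintegral_enorm_sq_const_smul_lt_top B
        (lintegral_enorm_sq_lt_top_of_norm_le (fun x => by rw [norm_norm]) l2Dw :
          ∫⁻ x, ‖(‖fderiv ℝ w x‖)‖ₑ ^ 2 < ⊤)
      simpa only [smul_eq_mul] using h
    refine lintegral_enorm_sq_lt_top_of_norm_le (fun x => ?_) hb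
    rw [Real.norm_of_nonneg (by positivity), FluidPDE.convect, mul_comm]
    exact (fderiv ℝ w x).le_opNorm_of_le (hB x)
  have l2conv₂ : ∫⁻ x, ‖FluidPDE.convect w v' x‖ₑ ^ 2 < ⊤ := by
    have hb : ∫⁻ x, ‖(2 * B) * ‖fderiv ℝ v' x‖‖ₑ ^ 2 < ⊤ := by
      have h := lintegral_enorm_sq_const_smul_lt_top (2 * B)
        (lintegral_enorm_sq_lt_top_of_norm_le (fun x => by rw [norm_norm]) l2Dv' :
          ∫⁻ x, ‖(‖fderiv ℝ v' x‖)‖ₑ ^ 2 < ⊤)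
      simpa only [smul_eq_mul] using h
    refine lintegral_enorm_sq_lt_top_of_norm_le (fun x => ?_) hb
    rw [Real.norm_of_nonneg (by positivity), FluidPDE.convect, mul_comm]
    exact (fderiv ℝ v' x).le_opNorm_of_le (hwB x)
  -- integrability of the pairings with `w`
  have c3D2 : Continuous fun x => (3 : ℝ) • iteratedFDeriv ℝ 2 w x := cD2w.const_smul (3 : ℝ)
  have iwΔ : Integrable (fun x => ⟪w x, (Δ w) x⟫) volume :=
    integrable_of_norm_le_mul_of_lintegral_sq (cw.inner cΔ).aestronglyMeasurable cw c3D2 l2w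
      (lintegral_enorm_sq_const_smul_lt_top 3 l2D2w)
      fun x => (norm_inner_le_norm _ _).trans (mul_le_mul_of_nonneg_left (n_Δ x) (norm_nonneg _))
  have iwg : Integrable (fun x => ⟪w x, gradient π x⟫) volume :=
    integrable_of_norm_le_mul_of_lintegral_sq (cw.inner cgπ).aestronglyMeasurable cw cgπ l2w l2gπ
      fun x => norm_inner_le_norm _ _
  have cconv₁ : Continuous (FluidPDE.convect v w) := cDw.clm_apply cv
  have cconv₂ : Continuous (FluidPDE.convect w v') := cDv'.clm_apply cw
  have iwc₁ : Integrable (fun x => ⟪w x, FluidPDE.convect v w x⟫) volume :=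
    integrable_of_norm_le_mul_of_lintegral_sq (cw.inner cconv₁).aestronglyMeasurable cw cconv₁ l2w
      l2conv₁ fun x => norm_inner_le_norm _ _
  have iwc₂ : Integrable (fun x => ⟪w x, FluidPDE.convect w v' x⟫) volume :=
    integrable_of_norm_le_mul_of_lintegral_sq (cw.inner cconv₂).aestronglyMeasurable cw cconv₂ l2w
      l2conv₂ fun x => norm_inner_le_norm _ _
  -- (i) diffusion: `∫ ⟪w, Δw⟫ = -∫ |∇w|²`
  have ifrob : Integrable (fun x => FluidPDE.frobeniusNormSq (fderiv ℝ w x)) volume := by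
    have hlt : ∫⁻ x, ENNReal.ofReal (FluidPDE.frobeniusNormSq (fderiv ℝ w x)) < ⊤ :=
      calc ∫⁻ x, ENNReal.ofReal (FluidPDE.frobeniusNormSq (fderiv ℝ w x))
          ≤ ∫⁻ x, 3 * ‖fderiv ℝ w x‖ₑ ^ 2 :=
            lintegral_mono fun x => ofReal_frobeniusNormSq_le_three_mul_enorm_sq _
        _ = 3 * ∫⁻ x, ‖fderiv ℝ w x‖ₑ ^ 2 := lintegral_const_mul' _ _ (by norm_num)
        _ < ⊤ := ENNReal.mul_lt_top (by norm_num) l2Dw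
    exact integrable_of_continuous_of_nonneg (FluidPDE.continuous_frobeniusNormSq_fderiv hw (by simp))
      (fun x => FluidPDE.frobeniusNormSq_nonneg _) hlt
  have hlfrob : ∫⁻ x, ENNReal.ofReal (FluidPDE.frobeniusNormSq (fderiv ℝ w x)) =
      ENNReal.ofReal (∫ x, FluidPDE.frobeniusNormSq (fderiv ℝ w x)) :=
    (ofReal_integral_eq_lintegral_ofReal ifrob
      (Eventually.of_forall fun x => FluidPDE.frobeniusNormSq_nonneg _)).symm
  have hdiff : ∫ x, ⟪w x, (Δ w) x⟫ = - ∫ x, FluidPDE.frobeniusNormSq (fderiv ℝ w x) := by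
    have i1 : ∀ i, Integrable (fun x => ⟪fderiv ℝ (fun y => fderiv ℝ w y (e i)) x (e i), w x⟫)
        volume := fun i =>
      integrable_of_norm_le_mul_of_lintegral_sq ((cddw i).inner cw).aestronglyMeasurable (cddw i) cw
        (l2ddw i) l2w fun x => norm_inner_le_norm _ _
    have i2 : ∀ i, Integrable (fun x => ⟪fderiv ℝ w x (e i), fderiv ℝ w x (e i)⟫) volume := fun i =>
      integrable_of_norm_le_mul_of_lintegral_sq ((cdiw i).inner (cdiw i)).aestronglyMeasurable
        (cdiw i) (cdiw i) (l2diw i) (l2diw i) fun x => norm_inner_le_norm _ _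
    have i3 : ∀ i, Integrable (fun x => ⟪fderiv ℝ w x (e i), w x⟫) volume := fun i =>
      integrable_of_norm_le_mul_of_lintegral_sq ((cdiw i).inner cw).aestronglyMeasurable (cdiw i) cw
        (l2diw i) l2w fun x => norm_inner_le_norm _ _
    have hG := integral_sum_inner_fderiv_fderiv_eq_neg_integral_inner_laplacian hw hw1 i1 i2 i3
    have hsum : ∫ x, ∑ i, ⟪fderiv ℝ w x (e i), fderiv ℝ w x (e i)⟫ =
        ∫ x, FluidPDE.frobeniusNormSq (fderiv ℝ w x) := by
      refine integral_congr_ae (Eventually.of_forall fun x => ?_)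
      simp only
      rw [FluidPDE.frobeniusNormSq_eq_sum e]
      exact Finset.sum_congr rfl fun i _ => real_inner_self_eq_norm_sq _
    have hcomm : ∫ x, ⟪w x, (Δ w) x⟫ = ∫ x, ⟪(Δ w) x, w x⟫ :=
      integral_congr_ae (Eventually.of_forall fun x => real_inner_comm _ _)
    rw [hcomm]
    linarith [hG, hsum]
  -- (ii) pressure: `∫ ⟪w, ∇π⟫ = 0`
  have hpress : ∫ x, ⟪w x, gradient π x⟫ = 0 := by
    have hswap : (fun x => ⟪w x, gradient π x⟫) = fun x => ⟪gradient π x, w x⟫ :=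
      funext fun x => real_inner_comm _ _
    rw [hswap]
    refine integral_inner_gradient_eq_zero_of_isDivFree_R3 hπ hw1 hdivw (fun i => ?_) (fun i => ?_)
      (fun i => ?_)
    · refine integrable_of_norm_le_mul_of_lintegral_sq
        ((continuous_const.inner cw).mul (cdiπ i)).aestronglyMeasurable cw (cdiπ i) l2w (l2diπ i)
        fun x => ?_
      rw [norm_mul]
      exact mul_le_mul (hin i _) le_rfl (norm_nonneg _) (norm_nonneg _)
    · refine integrable_of_norm_le_mul_of_lintegral_sq
        ((continuous_const.inner (cdiw i)).mul cπ).aestronglyMeasurable (cdiw i) cπ (l2diw i) l2π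
        fun x => ?_
      rw [norm_mul]
      exact mul_le_mul (hin i _) le_rfl (norm_nonneg _) (norm_nonneg _)
    · refine integrable_of_norm_le_mul_of_lintegral_sq
        ((continuous_const.inner cw).mul cπ).aestronglyMeasurable cw cπ l2w l2π fun x => ?_
      rw [norm_mul]
      exact mul_le_mul (hin i _) le_rfl (norm_nonneg _) (norm_nonneg _)
  -- (iii) transport: `∫ ⟪w, (v·∇)w⟫ = 0`
  have hwm : MemLp w 2 volume :=
    ⟨cw.aestronglyMeasurable, eLpNorm_two_lt_top_of_lintegral_enorm_sq_lt_top l2w⟩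
  have htrans : ∫ x, ⟪w x, FluidPDE.convect v w x⟫ = 0 := by
    have hwd : IsWeaklyDivFree v :=
      VectorCalculus.IsDivFree.isWeaklyDivFree_holds hdiv (hv.of_le (by norm_num))
    have hwg : HasWeakGradient w (fderiv ℝ w) := hasWeakGradient_fderiv_of_contDiff hw1
    have hG2 : ∫⁻ x, ENNReal.ofReal (FluidPDE.frobeniusNormSq (fderiv ℝ w x)) < ⊤ := by
      rw [hlfrob]; exact ENNReal.ofReal_lt_top
    have hvtop : MemLp v ⊤ volume :=
      memLp_top_of_bound cv.aestronglyMeasurable B (Eventually.of_forall hB)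
    have h := integral_inner_weakGrad_apply_self_eq_zero hwd hwg hG2 hwm (q := ⊤) (p := 2)
      (by norm_num) hvtop hwm
    have hswap : (fun x => ⟪w x, FluidPDE.convect v w x⟫) = fun x => ⟪fderiv ℝ w x (v x), w x⟫ :=
      funext fun x => by rw [FluidPDE.convect, real_inner_comm]
    rw [hswap]
    exact h
  -- (iv) the stretching term `T = ∫ ⟪w, (w·∇)v'⟫`
  obtain ⟨Ew, hEw⟩ : ∃ Ew : ℝ, Ew = ∫ x, ‖w x‖ ^ 2 := ⟨_, rfl⟩
  obtain ⟨DF, hDF⟩ : ∃ DF : ℝ, DF = ∫ x, FluidPDE.frobeniusNormSq (fderiv ℝ w x) := ⟨_, rfl⟩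
  obtain ⟨S', hS'⟩ : ∃ S' : ℝ, S' = ∫ x, FluidPDE.frobeniusNormSq (fderiv ℝ v' x) := ⟨_, rfl⟩
  obtain ⟨T, hT⟩ : ∃ T : ℝ, T = ∫ x, ⟪w x, FluidPDE.convect w v' x⟫ := ⟨_, rfl⟩
  have hEw0 : 0 ≤ Ew := by rw [hEw]; exact integral_nonneg fun x => sq_nonneg _
  have hDF0 : 0 ≤ DF := by rw [hDF]; exact integral_nonneg fun x => FluidPDE.frobeniusNormSq_nonneg _
  have hS'0 : 0 ≤ S' := by rw [hS']; exact integral_nonneg fun x => FluidPDE.frobeniusNormSq_nonneg _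
  -- `‖w‖²`, `‖w‖⁶` are integrable, `‖w‖² ∈ L²`
  have isq : Integrable (fun x => ‖w x‖ ^ 2) volume := FluidPDE.integrable_sq_norm_of_lintegral_lt_top cw l2w
  have l2wsq : ∫⁻ x, ‖(‖w x‖ ^ 2)‖ₑ ^ 2 < ⊤ := by
    have hb : ∫⁻ x, ‖(2 * B) * ‖w x‖‖ₑ ^ 2 < ⊤ := by
      have h := lintegral_enorm_sq_const_smul_lt_top (2 * B)
        (lintegral_enorm_sq_lt_top_of_norm_le (fun x => by rw [norm_norm]) l2w :
          ∫⁻ x, ‖(‖w x‖)‖ₑ ^ 2 < ⊤)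
      simpa only [smul_eq_mul] using h
    refine lintegral_enorm_sq_lt_top_of_norm_le (fun x => ?_) hb
    rw [Real.norm_of_nonneg (sq_nonneg _), Real.norm_of_nonneg (by positivity), sq]
    exact mul_le_mul_of_nonneg_right (hwB x) (norm_nonneg _)
  have csq : Continuous fun x => ‖w x‖ ^ 2 := cw.norm.pow 2
  have hsqm : MemLp (fun x => ‖w x‖ ^ 2) 2 volume :=
    ⟨csq.aestronglyMeasurable, eLpNorm_two_lt_top_of_lintegral_enorm_sq_lt_top l2wsq⟩
  have i6 : Integrable (fun x => ‖w x‖ ^ 6) volume := by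
    refine ((isq.const_mul ((2 * B) ^ 4))).mono' (cw.norm.pow 6).aestronglyMeasurable
      (Eventually.of_forall fun x => ?_)
    rw [Real.norm_of_nonneg (by positivity)]
    have h4 : ‖w x‖ ^ 4 ≤ (2 * B) ^ 4 := pow_le_pow_left₀ (norm_nonneg _) (hwB x) 4
    calc ‖w x‖ ^ 6 = ‖w x‖ ^ 4 * ‖w x‖ ^ 2 := by ring
      _ ≤ (2 * B) ^ 4 * ‖w x‖ ^ 2 := mul_le_mul_of_nonneg_right h4 (sq_nonneg _)
  -- `|T| ≤ ‖Dv'‖₂ ‖ ‖w‖² ‖₂`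
  have hDv'm : MemLp (fderiv ℝ v') 2 volume :=
    ⟨cDv'.aestronglyMeasurable, eLpNorm_two_lt_top_of_lintegral_enorm_sq_lt_top l2Dv'⟩
  have iprod : Integrable (fun x => ‖fderiv ℝ v' x‖ * ‖(‖w x‖ ^ 2)‖) volume := by
    have h := integrable_of_norm_le_mul_of_lintegral_sq (φ := fun x => ‖fderiv ℝ v' x‖ * ‖(‖w x‖ ^ 2)‖)
      ((cDv'.norm.mul csq.norm).aestronglyMeasurable) cDv' csq l2Dv' l2wsq fun x => by
        rw [Real.norm_of_nonneg (mul_nonneg (norm_nonneg _) (norm_nonneg _))]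
    exact h
  have hT1 : |T| ≤ ∫ x, ‖fderiv ℝ v' x‖ * ‖(‖w x‖ ^ 2)‖ := by
    rw [hT]
    refine (abs_integral_le_integral_abs).trans (integral_mono iwc₂.abs iprod fun x => ?_)
    simp only
    rw [Real.norm_of_nonneg (sq_nonneg _), FluidPDE.convect, ← Real.norm_eq_abs]
    calc ‖⟪w x, fderiv ℝ v' x (w x)⟫‖ ≤ ‖w x‖ * ‖fderiv ℝ v' x (w x)‖ := norm_inner_le_norm _ _
      _ ≤ ‖w x‖ * (‖fderiv ℝ v' x‖ * ‖w x‖) :=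
          mul_le_mul_of_nonneg_left ((fderiv ℝ v' x).le_opNorm _) (norm_nonneg _)
      _ = ‖fderiv ℝ v' x‖ * ‖w x‖ ^ 2 := by ring
  have hCS : ∫ x, ‖fderiv ℝ v' x‖ * ‖(‖w x‖ ^ 2)‖ ≤
      Real.sqrt (∫ x, ‖fderiv ℝ v' x‖ ^ 2) * Real.sqrt (∫ x, ‖w x‖ ^ 4) := by
    have h := integral_norm_mul_norm_le_sqrt_mul_sqrt hDv'm hsqm
    have hP : ∫ x, ‖(‖w x‖ ^ 2)‖ ^ 2 = ∫ x, ‖w x‖ ^ 4 :=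
      integral_congr_ae (Eventually.of_forall fun x => by
        simp only; rw [Real.norm_of_nonneg (sq_nonneg _)]; ring)
    rw [hP] at h
    exact h
  -- interpolation and Sobolev
  have hw6 : MemLp w 6 volume :=
    ⟨cw.aestronglyMeasurable, eLpNorm_lt_top_of_bound_of_two (by positivity) hwB l2w (by norm_num)⟩
  have hinterp : ∫ x, ‖w x‖ ^ 4 ≤ Real.sqrt Ew * Real.sqrt (∫ x, ‖w x‖ ^ 6) := by
    rw [hEw]; exact integral_norm_pow_four_le hwm hw6
  have hwg : HasWeakGradient w (fderiv ℝ w) := hasWeakGradient_fderiv_of_contDiff hw1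
  have hQ : ∫ x, ‖w x‖ ^ 6 ≤ (K : ℝ) ^ 6 * DF ^ 3 := by
    have iDw : Integrable (fun x => ‖fderiv ℝ w x‖ ^ 2) volume :=
      FluidPDE.integrable_sq_norm_of_lintegral_lt_top cDw l2Dw
    obtain ⟨d, hd⟩ : ∃ d : ℝ, d = ∫ x, ‖fderiv ℝ w x‖ ^ 2 := ⟨_, rfl⟩
    have hd0 : 0 ≤ d := by rw [hd]; exact integral_nonneg fun x => sq_nonneg _
    have hdDF : d ≤ DF := by
      rw [hd, hDF]; exact integral_mono iDw ifrob fun x => FluidPDE.sq_opNorm_le_frobeniusNormSq _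
    have hS6 : eLpNorm w 6 volume ≤ (K : ℝ≥0∞) * eLpNorm (fderiv ℝ w) 2 volume := by
      rw [hK]
      exact eLpNorm_six_le_eLpNorm_fderiv_two volume finrank_euclideanSpace_fin hw1 hwm.eLpNorm_lt_top
    have hM2 : eLpNorm (fderiv ℝ w) 2 volume ^ 2 = ENNReal.ofReal d := by
      rw [← lintegral_enorm_sq_eq_eLpNorm_two_sq, hd, ofReal_integral_sq_norm iDw]
    have h6 : eLpNorm w 6 volume ^ 6 ≤ ((K : ℝ≥0∞) * eLpNorm (fderiv ℝ w) 2 volume) ^ 6 := by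
      gcongr
    have hlhs : eLpNorm w 6 volume ^ 6 = ENNReal.ofReal (∫ x, ‖w x‖ ^ 6) := by
      rw [← lintegral_enorm_pow_six_eq_eLpNorm_pow,
        ofReal_integral_eq_lintegral_ofReal i6 (Eventually.of_forall fun x => by positivity)]
      refine lintegral_congr fun x => ?_
      rw [← ofReal_norm, ENNReal.ofReal_pow (norm_nonneg _)]
    have hrhs : ((K : ℝ≥0∞) * eLpNorm (fderiv ℝ w) 2 volume) ^ 6 =
        ENNReal.ofReal ((K : ℝ) ^ 6 * d ^ 3) := by
      have hp : eLpNorm (fderiv ℝ w) 2 volume ^ 6 = (eLpNorm (fderiv ℝ w) 2 volume ^ 2) ^ 3 := by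
        ring
      rw [mul_pow, hp, hM2, ← ENNReal.ofReal_pow hd0, ← ENNReal.ofReal_coe_nnreal,
        ← ENNReal.ofReal_pow K.coe_nonneg, ← ENNReal.ofReal_mul (by positivity)]
    rw [hlhs, hrhs] at h6
    have h7 := (ENNReal.ofReal_le_ofReal_iff (by positivity)).1 h6
    exact h7.trans (by gcongr)
  have hsqrtP : Real.sqrt (∫ x, ‖w x‖ ^ 4) ≤ (K : ℝ) ^ (3 / 2 : ℝ) * Ew ^ (1 / 4 : ℝ) * DF ^ (3 / 4 : ℝ) :=
    sqrt_le_of_interp_sobolev hEw0 K.coe_nonneg hDF0 hinterp hQ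
  -- `σ = ‖Dv'‖₂`, `σ⁴ ≤ S'²`
  obtain ⟨σ, hσ⟩ : ∃ σ : ℝ, σ = Real.sqrt (∫ x, ‖fderiv ℝ v' x‖ ^ 2) := ⟨_, rfl⟩
  have hσ0 : 0 ≤ σ := by rw [hσ]; exact Real.sqrt_nonneg _
  have hσ4 : σ ^ 4 ≤ S' ^ 2 := by
    have iDv' : Integrable (fun x => ‖fderiv ℝ v' x‖ ^ 2) volume :=
      FluidPDE.integrable_sq_norm_of_lintegral_lt_top cDv' l2Dv'
    have ifrob' : Integrable (fun x => FluidPDE.frobeniusNormSq (fderiv ℝ v' x)) volume := by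
      have hlt : ∫⁻ x, ENNReal.ofReal (FluidPDE.frobeniusNormSq (fderiv ℝ v' x)) < ⊤ :=
        calc ∫⁻ x, ENNReal.ofReal (FluidPDE.frobeniusNormSq (fderiv ℝ v' x))
            ≤ ∫⁻ x, 3 * ‖fderiv ℝ v' x‖ₑ ^ 2 :=
              lintegral_mono fun x => ofReal_frobeniusNormSq_le_three_mul_enorm_sq _
          _ = 3 * ∫⁻ x, ‖fderiv ℝ v' x‖ₑ ^ 2 := lintegral_const_mul' _ _ (by norm_num)
          _ < ⊤ := ENNReal.mul_lt_top (by norm_num) l2Dv'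
      exact integrable_of_continuous_of_nonneg
        (FluidPDE.continuous_frobeniusNormSq_fderiv hv' (by simp))
        (fun x => FluidPDE.frobeniusNormSq_nonneg _) hlt
    have ha : ∫ x, ‖fderiv ℝ v' x‖ ^ 2 ≤ S' := by
      rw [hS']; exact integral_mono iDv' ifrob' fun x => FluidPDE.sq_opNorm_le_frobeniusNormSq _
    have ha0 : 0 ≤ ∫ x, ‖fderiv ℝ v' x‖ ^ 2 := integral_nonneg fun x => sq_nonneg _
    have hσ2 : σ ^ 2 = ∫ x, ‖fderiv ℝ v' x‖ ^ 2 := by rw [hσ, Real.sq_sqrt ha0]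
    calc σ ^ 4 = (σ ^ 2) ^ 2 := by ring
      _ ≤ S' ^ 2 := by rw [hσ2]; exact pow_le_pow_left₀ ha0 ha 2
  -- Young's inequality with absorption
  have hTle : |T| ≤ (σ * (K : ℝ) ^ (3 / 2 : ℝ)) * Ew ^ θ * DF ^ (1 - θ) := by
    have h34 : (1 : ℝ) - θ = 3 / 4 := by rw [hθdef]; norm_num
    rw [h34, hθdef]
    calc |T| ≤ σ * Real.sqrt (∫ x, ‖w x‖ ^ 4) := by rw [hσ]; exact hT1.trans hCS
      _ ≤ σ * ((K : ℝ) ^ (3 / 2 : ℝ) * Ew ^ (1 / 4 : ℝ) * DF ^ (3 / 4 : ℝ)) :=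
          mul_le_mul_of_nonneg_left hsqrtP hσ0
      _ = σ * (K : ℝ) ^ (3 / 2 : ℝ) * Ew ^ (1 / 4 : ℝ) * DF ^ (3 / 4 : ℝ) := by ring
  have ha0 : 0 ≤ σ * (K : ℝ) ^ (3 / 2 : ℝ) := by positivity
  have hYoung := mul_rpow_mul_rpow_le_absorb hθ0 hθ1 hν ha0 hDF0 hEw0
  rw [← hC₀] at hYoung
  -- the exponents at `θ = 1/4`
  have hexp1 : ν ^ (-((1 - θ) / θ)) = (ν ^ 3)⁻¹ := by
    have : -((1 - θ) / θ) = -((3 : ℕ) : ℝ) := by rw [hθdef]; norm_num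
    rw [this, Real.rpow_neg hν.le, Real.rpow_natCast]
  have hexp2 : (σ * (K : ℝ) ^ (3 / 2 : ℝ)) ^ (1 / θ) = σ ^ 4 * (K : ℝ) ^ 6 := by
    have : (1 : ℝ) / θ = ((4 : ℕ) : ℝ) := by rw [hθdef]; norm_num
    rw [this, Real.rpow_natCast, mul_pow, ← Real.rpow_natCast ((K : ℝ) ^ (3 / 2 : ℝ)) 4,
      ← Real.rpow_mul K.coe_nonneg]
    norm_num
  rw [hexp1, hexp2] at hYoung
  have hTbound : |T| ≤ ν / 2 * DF + C₀ * (ν ^ 3)⁻¹ * (σ ^ 4 * (K : ℝ) ^ 6) * Ew :=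
    hTle.trans hYoung
  -- the identity `∫ ⟪w, W⟫ = -ν DF - T`
  have hident : ∫ x, ⟪w x, W x⟫ = -ν * DF - T := by
    have hpt : ∀ x, ⟪w x, W x⟫ =
        ν * ⟪w x, (Δ w) x⟫ - ⟪w x, gradient π x⟫ - ⟪w x, FluidPDE.convect v w x⟫ -
          ⟪w x, FluidPDE.convect w v' x⟫ := fun x => by
      rw [hmom x, inner_sub_right, inner_sub_right, inner_sub_right, real_inner_smul_right]
    have iA : Integrable (fun x => ν * ⟪w x, (Δ w) x⟫) volume := iwΔ.const_mul ν
    have iAB : Integrable (fun x => ν * ⟪w x, (Δ w) x⟫ - ⟪w x, gradient π x⟫) volume := by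
      exact iA.sub iwg
    have iABC : Integrable (fun x => ν * ⟪w x, (Δ w) x⟫ - ⟪w x, gradient π x⟫ -
        ⟪w x, FluidPDE.convect v w x⟫) volume := by
      exact iAB.sub iwc₁
    have e1 : ∫ x, (ν * ⟪w x, (Δ w) x⟫ - ⟪w x, gradient π x⟫ - ⟪w x, FluidPDE.convect v w x⟫ -
        ⟪w x, FluidPDE.convect w v' x⟫) =
        (∫ x, (ν * ⟪w x, (Δ w) x⟫ - ⟪w x, gradient π x⟫ - ⟪w x, FluidPDE.convect v w x⟫)) -
          ∫ x, ⟪w x, FluidPDE.convect w v' x⟫ := integral_sub iABC iwc₂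
    have e2 : ∫ x, (ν * ⟪w x, (Δ w) x⟫ - ⟪w x, gradient π x⟫ - ⟪w x, FluidPDE.convect v w x⟫) =
        (∫ x, (ν * ⟪w x, (Δ w) x⟫ - ⟪w x, gradient π x⟫)) - ∫ x, ⟪w x, FluidPDE.convect v w x⟫ :=
      integral_sub iAB iwc₁
    have e3 : ∫ x, (ν * ⟪w x, (Δ w) x⟫ - ⟪w x, gradient π x⟫) =
        (∫ x, ν * ⟪w x, (Δ w) x⟫) - ∫ x, ⟪w x, gradient π x⟫ := integral_sub iA iwg
    have e4 : ∫ x, ν * ⟪w x, (Δ w) x⟫ = ν * ∫ x, ⟪w x, (Δ w) x⟫ := integral_const_mul _ _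
    rw [integral_congr_ae (Eventually.of_forall hpt), e1, e2, e3, e4, hdiff, hpress, htrans, ← hT,
      ← hDF]
    ring
  -- conclude
  have hν3 : 0 ≤ (ν ^ 3)⁻¹ := by positivity
  have hσK : C₀ * (ν ^ 3)⁻¹ * (σ ^ 4 * (K : ℝ) ^ 6) * Ew ≤ C₀ * (ν ^ 3)⁻¹ * (S' ^ 2 * (K : ℝ) ^ 6) * Ew := by
    gcongr
  have habsT : -T ≤ |T| := neg_le_abs T
  have hgoal : 2 * ∫ x, ⟪v x - v' x, W₁ x - W₂ x⟫ = 2 * ∫ x, ⟪w x, W x⟫ := by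
    congr 1
    exact integral_congr_ae (Eventually.of_forall fun x => by simp only [hwx, hWx])
  have hEgoal : ∫ x, ‖v x - v' x‖ ^ 2 = Ew := by
    rw [hEw]; exact integral_congr_ae (Eventually.of_forall fun x => by simp only [hwx])
  rw [hgoal, hEgoal, ← hS', hident]
  nlinarith [hTbound, hσK, habsT, hDF0, hν.le, mul_nonneg hC₀0 hν3]

end Slice

/-! ### The `L²` stability estimate on a slab -/

section Slab

/-- `∫⁻ ‖f - g‖² ≤ 2 ∫⁻ ‖f‖² + 2 ∫⁻ ‖g‖²` (measurable `f`). [folklore] -/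
theorem lintegral_enorm_sq_sub_le {α : Type*} [MeasurableSpace α] {μ : Measure α}
    {G : Type*} [NormedAddCommGroup G] {f g : α → G} (hf : AEStronglyMeasurable f μ) :
    ∫⁻ x, ‖f x - g x‖ₑ ^ 2 ∂μ ≤ 2 * (∫⁻ x, ‖f x‖ₑ ^ 2 ∂μ) + 2 * ∫⁻ x, ‖g x‖ₑ ^ 2 ∂μ := by
  have hpt : ∀ x, ‖f x - g x‖ₑ ^ 2 ≤ 2 * ‖f x‖ₑ ^ 2 + 2 * ‖g x‖ₑ ^ 2 := by
    intro x
    have h1 : ‖f x - g x‖ ^ 2 ≤ 2 * ‖f x‖ ^ 2 + 2 * ‖g x‖ ^ 2 := by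
      nlinarith [norm_sub_le (f x) (g x), norm_nonneg (f x - g x), sq_nonneg (‖f x‖ - ‖g x‖),
        norm_nonneg (f x), norm_nonneg (g x)]
    have h2 : ENNReal.ofReal (‖f x - g x‖ ^ 2) ≤ ENNReal.ofReal (2 * ‖f x‖ ^ 2 + 2 * ‖g x‖ ^ 2) :=
      ENNReal.ofReal_le_ofReal h1
    rw [ENNReal.ofReal_add (by positivity) (by positivity), ENNReal.ofReal_mul zero_le_two,
      ENNReal.ofReal_mul zero_le_two, ENNReal.ofReal_pow (norm_nonneg _),
      ENNReal.ofReal_pow (norm_nonneg _), ENNReal.ofReal_pow (norm_nonneg _), ofReal_norm,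
      ofReal_norm, ofReal_norm, ENNReal.ofReal_ofNat] at h2
    exact h2
  calc ∫⁻ x, ‖f x - g x‖ₑ ^ 2 ∂μ ≤ ∫⁻ x, (2 * ‖f x‖ₑ ^ 2 + 2 * ‖g x‖ₑ ^ 2) ∂μ := lintegral_mono hpt
    _ = (∫⁻ x, 2 * ‖f x‖ₑ ^ 2 ∂μ) + ∫⁻ x, 2 * ‖g x‖ₑ ^ 2 ∂μ :=
        lintegral_add_left' ((hf.enorm.pow_const 2).const_mul 2) _
    _ = 2 * (∫⁻ x, ‖f x‖ₑ ^ 2 ∂μ) + 2 * ∫⁻ x, ‖g x‖ₑ ^ 2 ∂μ := by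
        rw [lintegral_const_mul' _ _ (by simp), lintegral_const_mul' _ _ (by simp)]

/-- **`L²` stability of classical solutions in the smooth `H¹` class** (Robinson–Rodrigo–Sadowski
2016, proof of Thm. 6.10 and (6.3); Tao 2011, Thm. 5.4 (v), `L²` part): there is an absolute
constant `C ≥ 0` such that for two classical solutions `(u, p)`, `(u', p')` of the unforced
Navier–Stokes system (same viscosity `ν > 0`) on `[0, T] × ℝ³`, both with
`u, ∂ₜu, p ∈ L^∞_t H^k_x` for all `k`, and `S ≥ ∫|∇u'(t)|²` on `[0, T]`:
`∫‖u(t) − u'(t)‖² ≤ ∫‖u(0) − u'(0)‖² · exp(C ν⁻³ S² t)` for all `t ∈ [0, T]`.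
Proof: `IsSmoothSpaceTimeOn.l2_balance` for `w = u − u'`, the slice inequality `exists_l2_slice`
at every time, and Grönwall's lemma (`le_mul_exp_of_le_add_mul_integral`). [cite: RobinsonRodrigoSadowski2016, Thm. 6.10 (proof) and (6.3)] -/
theorem exists_l2_stability :
    ∃ C : ℝ, 0 ≤ C ∧ ∀ ⦃ν T : ℝ⦄ (_ : 0 < ν) (_ : 0 < T)
      ⦃u u' : ℝ → EuclideanSpace ℝ (Fin 3) → EuclideanSpace ℝ (Fin 3)⦄
      ⦃p p' : ℝ → EuclideanSpace ℝ (Fin 3) → ℝ⦄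
      (_ : FluidPDE.IsClassicalNSSolutionOn (Icc 0 T) ν 0 u p)
      (_ : FluidPDE.IsClassicalNSSolutionOn (Icc 0 T) ν 0 u' p')
      (_ : HasBoundedSobolevNormsOn (Icc 0 T) u)
      (_ : HasBoundedSobolevNormsOn (Icc 0 T) (FluidPDE.timeDerivWithin (Icc 0 T) u))
      (_ : ∀ n : ℕ, ∃ C' : ℝ≥0, ∀ t ∈ Icc 0 T, ∫⁻ x, ‖iteratedFDeriv ℝ n (p t) x‖ₑ ^ 2 ≤ C')
      (_ : HasBoundedSobolevNormsOn (Icc 0 T) u')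
      (_ : HasBoundedSobolevNormsOn (Icc 0 T) (FluidPDE.timeDerivWithin (Icc 0 T) u'))
      (_ : ∀ n : ℕ, ∃ C' : ℝ≥0, ∀ t ∈ Icc 0 T, ∫⁻ x, ‖iteratedFDeriv ℝ n (p' t) x‖ₑ ^ 2 ≤ C')
      ⦃S : ℝ⦄ (_ : ∀ t ∈ Icc 0 T, ∫ x, FluidPDE.frobeniusNormSq (fderiv ℝ (u' t) x) ≤ S),
      ∀ t ∈ Icc 0 T, ∫ x, ‖u t x - u' t x‖ ^ 2 ≤
        (∫ x, ‖u 0 x - u' 0 x‖ ^ 2) * Real.exp (C * (ν ^ 3)⁻¹ * S ^ 2 * t) := by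
  obtain ⟨C, hC0, hslice⟩ := exists_l2_slice
  refine ⟨C, hC0, ?_⟩
  intro ν T hν hT u u' p p' hsol hsol' hu hut hp hu' hut' hp' S hS
  have hU : UniqueDiffOn ℝ (Icc 0 T) := uniqueDiffOn_Icc hT
  -- the difference and its time derivative
  obtain ⟨w, hwdef⟩ : ∃ w : ℝ → EuclideanSpace ℝ (Fin 3) → EuclideanSpace ℝ (Fin 3),
      w = fun t x => u t x - u' t x := ⟨_, rfl⟩
  have hwtx : ∀ t x, w t x = u t x - u' t x := fun t x => by rw [hwdef]
  have hwsm : FluidPDE.IsSmoothSpaceTimeOn (Icc 0 T) w := by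
    rw [hwdef]; exact hsol.smooth_velocity.sub hsol'.smooth_velocity
  have hWt : ∀ t ∈ Icc 0 T, ∀ x, FluidPDE.timeDerivWithin (Icc 0 T) w t x =
      FluidPDE.timeDerivWithin (Icc 0 T) u t x - FluidPDE.timeDerivWithin (Icc 0 T) u' t x := by
    intro t ht x
    rw [hwdef]
    exact hsol.smooth_velocity.timeDerivWithin_fun_sub hsol'.smooth_velocity hU ht x
  -- class bounds
  obtain ⟨B, hB⟩ := linfty_bound_of_hasBoundedSobolevNormsOn_holds
    (fun t ht => (hsol.contDiff_velocity ht).of_le (by norm_cast)) hu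
  obtain ⟨B', hB'⟩ := linfty_bound_of_hasBoundedSobolevNormsOn_holds
    (fun t ht => (hsol'.contDiff_velocity ht).of_le (by norm_cast)) hu'
  obtain ⟨C₀, hC₀⟩ := hu 0
  obtain ⟨C₁, hC₁⟩ := hu 1
  obtain ⟨C₂, hC₂⟩ := hu 2
  obtain ⟨C₀', hC₀'⟩ := hu' 0
  obtain ⟨C₁', hC₁'⟩ := hu' 1
  obtain ⟨C₂', hC₂'⟩ := hu' 2
  obtain ⟨E₀, hE₀⟩ := hut 0
  obtain ⟨E₀', hE₀'⟩ := hut' 0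
  obtain ⟨P₀, hP₀⟩ := hp 0
  obtain ⟨P₁, hP₁⟩ := hp 1
  obtain ⟨P₀', hP₀'⟩ := hp' 0
  obtain ⟨P₁', hP₁'⟩ := hp' 1
  have hzero : ∀ {f : EuclideanSpace ℝ (Fin 3) → EuclideanSpace ℝ (Fin 3)} {C' : ℝ≥0},
      (∫⁻ x, ‖iteratedFDeriv ℝ 0 f x‖ₑ ^ 2 ≤ C') → ∫⁻ x, ‖f x‖ₑ ^ 2 ≤ C' := by
    intro f C' h
    refine (le_of_eq (lintegral_congr fun x => ?_)).trans h
    rw [← ofReal_norm, ← ofReal_norm, norm_iteratedFDeriv_zero]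
  have hzero' : ∀ {f : EuclideanSpace ℝ (Fin 3) → ℝ} {C' : ℝ≥0},
      (∫⁻ x, ‖iteratedFDeriv ℝ 0 f x‖ₑ ^ 2 ≤ C') → ∫⁻ x, ‖f x‖ₑ ^ 2 < ⊤ := by
    intro f C' h
    refine lt_of_le_of_lt ((le_of_eq (lintegral_congr fun x => ?_)).trans h) ENNReal.coe_lt_top
    rw [← ofReal_norm, ← ofReal_norm, norm_iteratedFDeriv_zero]
  -- `L²` bounds for `w` and `∂ₜ w`
  have hwL2 : ∀ t ∈ Icc 0 T, ∫⁻ x, ‖w t x‖ₑ ^ 2 ≤ (2 * C₀ + 2 * C₀' : ℝ≥0) := by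
    intro t ht
    have h := lintegral_enorm_sq_sub_le (g := u' t) ((hsol.contDiff_velocity ht).continuous.aestronglyMeasurable)
      (μ := volume)
    calc ∫⁻ x, ‖w t x‖ₑ ^ 2 = ∫⁻ x, ‖u t x - u' t x‖ₑ ^ 2 := lintegral_congr fun x => by rw [hwtx]
      _ ≤ 2 * (∫⁻ x, ‖u t x‖ₑ ^ 2) + 2 * ∫⁻ x, ‖u' t x‖ₑ ^ 2 := h
      _ ≤ 2 * (C₀ : ℝ≥0∞) + 2 * (C₀' : ℝ≥0∞) := by
          gcongr
          · exact hzero (hC₀ t ht)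
          · exact hzero (hC₀' t ht)
      _ = ((2 * C₀ + 2 * C₀' : ℝ≥0) : ℝ≥0∞) := by push_cast; rfl
  have hWL2 : ∀ t ∈ Icc 0 T, ∫⁻ x, ‖FluidPDE.timeDerivWithin (Icc 0 T) w t x‖ₑ ^ 2 ≤
      (2 * E₀ + 2 * E₀' : ℝ≥0) := by
    intro t ht
    have hsm := (hsol.smooth_velocity.timeDerivWithin hU).contDiff_slice ht
    have h := lintegral_enorm_sq_sub_le (g := FluidPDE.timeDerivWithin (Icc 0 T) u' t)
      (hsm.continuous.aestronglyMeasurable) (μ := volume)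
    calc ∫⁻ x, ‖FluidPDE.timeDerivWithin (Icc 0 T) w t x‖ₑ ^ 2
        = ∫⁻ x, ‖FluidPDE.timeDerivWithin (Icc 0 T) u t x - FluidPDE.timeDerivWithin (Icc 0 T) u' t x‖ₑ ^ 2 :=
          lintegral_congr fun x => by rw [hWt t ht]
      _ ≤ 2 * (∫⁻ x, ‖FluidPDE.timeDerivWithin (Icc 0 T) u t x‖ₑ ^ 2) +
          2 * ∫⁻ x, ‖FluidPDE.timeDerivWithin (Icc 0 T) u' t x‖ₑ ^ 2 := h
      _ ≤ 2 * (E₀ : ℝ≥0∞) + 2 * (E₀' : ℝ≥0∞) := by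
          gcongr
          · exact hzero (hE₀ t ht)
          · exact hzero (hE₀' t ht)
      _ = ((2 * E₀ + 2 * E₀' : ℝ≥0) : ℝ≥0∞) := by push_cast; rfl
  -- the balance
  obtain ⟨hΦint, hEcont, hEb⟩ := hwsm.l2_balance hT hwL2 hWL2
  obtain ⟨E, hEdef⟩ : ∃ E : ℝ → ℝ, E = fun t => ∫ x, ‖w t x‖ ^ 2 := ⟨_, rfl⟩
  have hEt : ∀ t, E t = ∫ x, ‖w t x‖ ^ 2 := fun t => by rw [hEdef]
  obtain ⟨Φ, hΦdef⟩ : ∃ Φ : ℝ → ℝ,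
      Φ = fun t => ∫ x, 2 * ⟪w t x, FluidPDE.timeDerivWithin (Icc 0 T) w t x⟫ := ⟨_, rfl⟩
  have hΦt : ∀ t, Φ t = ∫ x, 2 * ⟪w t x, FluidPDE.timeDerivWithin (Icc 0 T) w t x⟫ :=
    fun t => by rw [hΦdef]
  rw [← hΦdef] at hΦint
  rw [← hEdef] at hEcont
  have hEb' : ∀ b ∈ Ioc 0 T, E b = E 0 + ∫ t in (0 : ℝ)..b, Φ t := by
    intro b hb
    rw [hEt, hEt, hΦdef]
    exact hEb b hb
  have hE0 : ∀ t, 0 ≤ E t := fun t => by rw [hEt]; exact integral_nonneg fun x => sq_nonneg _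
  -- the slice inequality at each time: `Φ t ≤ κ E t`
  set κ : ℝ := C * (ν ^ 3)⁻¹ * S ^ 2 with hκ
  have hS0 : 0 ≤ S := le_trans (integral_nonneg fun x => FluidPDE.frobeniusNormSq_nonneg _)
    (hS 0 ⟨le_rfl, hT.le⟩)
  have hκ0 : 0 ≤ κ := by positivity
  have hslab : ∀ t ∈ Icc 0 T, Φ t ≤ κ * E t := by
    intro t ht
    set Bm : ℝ := max B B' with hBm
    have hmom : ∀ x, FluidPDE.timeDerivWithin (Icc 0 T) u t x + FluidPDE.convect (u t) (u t) x =
        ν • (Δ (u t)) x - gradient (p t) x := fun x => by simpa using hsol.momentum t ht x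
    have hmom' : ∀ x, FluidPDE.timeDerivWithin (Icc 0 T) u' t x + FluidPDE.convect (u' t) (u' t) x =
        ν • (Δ (u' t)) x - gradient (p' t) x := fun x => by simpa using hsol'.momentum t ht x
    have hsl := hslice hν ((hsol.contDiff_velocity ht).of_le (by norm_cast))
      ((hsol'.contDiff_velocity ht).of_le (by norm_cast))
      (((hsol.smooth_velocity.timeDerivWithin hU).contDiff_slice ht).of_le (by norm_cast))
      (((hsol'.smooth_velocity.timeDerivWithin hU).contDiff_slice ht).of_le (by norm_cast))
      ((hsol.contDiff_pressure ht).of_le (by norm_cast)) ((hsol'.contDiff_pressure ht).of_le (by norm_cast))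
      hmom hmom' (hsol.divFree t ht) (hsol'.divFree t ht)
      (fun x => (hB t ht x).trans (le_max_left B B')) (fun x => (hB' t ht x).trans (le_max_right B B'))
      ((hzero (hC₀ t ht)).trans_lt ENNReal.coe_lt_top) ((hC₁ t ht).trans_lt ENNReal.coe_lt_top)
      ((hC₂ t ht).trans_lt ENNReal.coe_lt_top)
      ((hzero (hC₀' t ht)).trans_lt ENNReal.coe_lt_top) ((hC₁' t ht).trans_lt ENNReal.coe_lt_top)
      ((hC₂' t ht).trans_lt ENNReal.coe_lt_top)
      ((hzero (hE₀ t ht)).trans_lt ENNReal.coe_lt_top) ((hzero (hE₀' t ht)).trans_lt ENNReal.coe_lt_top)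
      (hzero' (hP₀ t ht)) ((hP₁ t ht).trans_lt ENNReal.coe_lt_top)
      (hzero' (hP₀' t ht)) ((hP₁' t ht).trans_lt ENNReal.coe_lt_top)
    -- `Φ t = 2 ∫ ⟪u t - u' t, ∂ₜu t - ∂ₜu' t⟫`
    have hΦeq : Φ t = 2 * ∫ x, ⟪u t x - u' t x,
        FluidPDE.timeDerivWithin (Icc 0 T) u t x - FluidPDE.timeDerivWithin (Icc 0 T) u' t x⟫ := by
      rw [hΦt, integral_const_mul]
      congr 1
      exact integral_congr_ae (Eventually.of_forall fun x => by simp only [hwtx, hWt t ht])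
    have hEeq : E t = ∫ x, ‖u t x - u' t x‖ ^ 2 := by
      rw [hEt]; exact integral_congr_ae (Eventually.of_forall fun x => by simp only [hwtx])
    have hG : (∫ x, FluidPDE.frobeniusNormSq (fderiv ℝ (u' t) x)) ^ 2 ≤ S ^ 2 :=
      pow_le_pow_left₀ (integral_nonneg fun x => FluidPDE.frobeniusNormSq_nonneg _) (hS t ht) 2
    rw [hΦeq, hEeq, hκ]
    refine hsl.trans ?_
    have hEnn : 0 ≤ ∫ x, ‖u t x - u' t x‖ ^ 2 := integral_nonneg fun x => sq_nonneg _
    have hν3 : 0 ≤ (ν ^ 3)⁻¹ := by positivity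
    have := mul_le_mul_of_nonneg_left hG (mul_nonneg hC0 hν3)
    nlinarith [this, hEnn]
  -- Grönwall
  have hle : ∀ t ∈ Icc 0 T, E t ≤ E 0 + κ * ∫ s in (0 : ℝ)..t, E s := by
    intro t ht
    rcases eq_or_lt_of_le ht.1 with h0 | h0
    · rw [← h0, intervalIntegral.integral_same, mul_zero, add_zero]
    have hΦii : IntervalIntegrable Φ volume 0 t :=
      (intervalIntegrable_iff_integrableOn_Ioo_of_le h0.le).2
        (hΦint.mono_set (Ioo_subset_Ioo le_rfl ht.2))
    have hEc : ContinuousOn (fun s => κ * E s) (Icc 0 t) :=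
      continuousOn_const.mul (hEcont.mono (Icc_subset_Icc le_rfl ht.2))
    have hmono : ∫ s in (0 : ℝ)..t, Φ s ≤ ∫ s in (0 : ℝ)..t, κ * E s :=
      intervalIntegral.integral_mono_on h0.le hΦii (hEc.intervalIntegrable_of_Icc h0.le)
        fun s hs => hslab s ⟨hs.1, hs.2.trans ht.2⟩
    rw [hEb' t ⟨h0, ht.2⟩]
    rw [intervalIntegral.integral_const_mul] at hmono
    linarith
  have hgron := le_mul_exp_of_le_add_mul_integral hEcont hκ0 hle
  intro t ht
  have h := hgron t ht
  rw [hEt, hEt] at h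
  have e1 : ∫ x, ‖w t x‖ ^ 2 = ∫ x, ‖u t x - u' t x‖ ^ 2 :=
    integral_congr_ae (Eventually.of_forall fun x => by simp only [hwtx])
  have e0 : ∫ x, ‖w 0 x‖ ^ 2 = ∫ x, ‖u 0 x - u' 0 x‖ ^ 2 :=
    integral_congr_ae (Eventually.of_forall fun x => by simp only [hwtx])
  rw [e1, e0] at h
  exact h

end Slab

end Literature.Analysis.FluidPDE

end
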